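import Literature.MathematicalPhysics.QuantumLattice.HubbardPolymerBounds
import Literature.Probability.LatticeModels.WeightedSmallActivity
import Mathlib
import HarnessLib

/-!
# Kotecký–Preiss smallness of a pushforward site activity from a bond-weight bound (K2 groundwork, part 9)

Helper file for route `TcThermcert1`, crux `ThermalStiffnessCeilingU8b10_le_1o8` (item `stmt-Ventures-26381`), line
`Cruxes/ThermalStiffnessCeilingU8b10_le_1o8/Lines/zerofree_corridor.lean` v9, registered stub K2 `stub_gcHighTempAnalytic`, step S4c of
`Cruxes/…/STUB-PLAN-stub_gcHighTempAnalytic.md`.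

The tree's one-site Kotecký–Preiss bound `HubbardPolymerBounds.sum_norm_siteActivity_mul_exp_le` is stated for the Hubbard site activity
at one chemical potential; its proof only uses the bond-weight bound `|w(X)| ≤ (e²|τ|)^{|X|} r^{|supp X|}`. This file records the ABSTRACT
version, for an arbitrary bond weight `W : Finset (Bond Λ) → ℂ` satisfying `|W X| ≤ (e² s)^{|X|} r^{|supp X|}` on the connected bond sets of a
graph of maximal degree `Δ` — exactly the output of part 5 (`TcThermcert1GcWeightBound.norm_weight_le_of_activityBound`) with the two-fugacity
site ratio of part 7 — so that the two-complex-fugacity polymer gas of part 4 inherits the counting verbatim: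

* `sum_norm_pushforward_mul_exp_le_of_weight_bound`: with `λ = e⁶ r₀² s`, `r ≤ r₀`, `1 ≤ r₀`, `(8Δ+1)² λ ≤ 1/2`:
  `Σ_{A ∈ 𝒜} |ρ_W(A)| e^{2|A|} ≤ 8Δλ` for every family `𝒜` of site sets through a site `x`, where
  `ρ_W = pushforwardActivity (cellSupp Bond.verts) W (connectedCellSets Bond.verts (hubbardBonds G))`;
* `pushforwardActivity_connectedCellSets_empty`: `ρ_W(∅) = 0`;
* `isSmallActivityA_pushforward_of_weight_bound`: hence `IsSmallActivityA ρ_W a δ` whenever `a + δ ≤ 2` and `8Δλ ≤ a`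
  (the hypothesis of the tree's convergent cluster expansion `WeightedSmallActivity.IsSmallActivityA.exp_polymerLogZ`).

[cite: Ueltschi1999, §2.3 and §3; KoteckyPreiss1986, Theorem p. 492] Pure counting; no physics claim — nothing about superconductivity in the
Hubbard model is proved by anything in this file. No definitions; no `sorry`.
-/

noncomputable section

namespace Summit.Ventures.CertifiedManyBodySolver.Theorems.TcThermcert1.ZeroFreeCorridor

open Finset Complex
open Literature.MathematicalPhysics.QuantumLattice Literature.Probability.LatticeModels

variable {Λ : Type*} [LinearOrder Λ] [Fintype Λ] {G : SimpleGraph Λ} [DecidableRel G.Adj] {Δ : ℕ}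

omit [Fintype Λ] in
/-- Polymers are supports of NON-EMPTY connected bond sets: the pushforward activity vanishes at `∅`. -/
theorem pushforwardActivity_connectedCellSets_empty (W : Finset (Bond Λ) → ℂ) (P : Finset (Bond Λ)) :
    pushforwardActivity (cellSupp Bond.verts) W (connectedCellSets Bond.verts P) ∅ = 0 := by
  rw [pushforwardActivity_apply]
  refine Finset.sum_eq_zero fun X hX => ?_
  obtain ⟨hXP, hXA⟩ := Finset.mem_filter.1 hX
  exact absurd hXA (Finset.nonempty_iff_ne_empty.1 (cellSupp_nonempty verts_nonempty (mem_connectedCellSets.1 hXP).2.1))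

/-- **One-site Kotecký–Preiss bound for a pushforward activity from a bond-weight bound** (abstract form of the tree's
`sum_norm_siteActivity_mul_exp_le`): on a graph of maximal degree `Δ`, if `|W X| ≤ (e² s)^{|X|} r^{|supp X|}` for every connected bond set `X`,
`0 ≤ s`, `0 ≤ r ≤ r₀`, `1 ≤ r₀` and `(8Δ+1)² λ ≤ 1/2` with `λ = e⁶ r₀² s`, then for every site `x` and every finite family `𝒜` of site sets
containing `x`, `Σ_{A ∈ 𝒜} |ρ_W(A)| e^{2|A|} ≤ 8Δλ`. -/
theorem sum_norm_pushforward_mul_exp_le_of_weight_bound (hΔ : ∀ v : Λ, (Finset.univ.filter (G.Adj v)).card ≤ Δ)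
    (W : Finset (Bond Λ) → ℂ) {s r r₀ : ℝ} (hs0 : 0 ≤ s) (hr0 : 0 ≤ r) (hr : r ≤ r₀) (hr₀ : 1 ≤ r₀)
    (hW : ∀ X ∈ connectedCellSets Bond.verts (hubbardBonds G), ‖W X‖ ≤ (Real.exp 2 * s) ^ X.card * r ^ (cellSupp Bond.verts X).card)
    (hsmall : ((8 * Δ : ℕ) + 1 : ℝ) ^ 2 * (Real.exp 6 * r₀ ^ 2 * s) ≤ 1 / 2)
    (x : Λ) (𝒜 : Finset (Finset Λ)) (h𝒜 : ∀ A ∈ 𝒜, x ∈ A) :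
    ∑ A ∈ 𝒜, ‖pushforwardActivity (cellSupp Bond.verts) W (connectedCellSets Bond.verts (hubbardBonds G)) A‖ *
        Real.exp (2 * A.card) ≤ 8 * Δ * (Real.exp 6 * r₀ ^ 2 * s) := by
  classical
  set lam : ℝ := Real.exp 6 * r₀ ^ 2 * s with hlam
  have hlam0 : 0 ≤ lam := by positivity
  set D := hubbardBonds G with hD
  set CC := connectedCellSets Bond.verts D with hCC
  set f : Finset (Bond Λ) → ℝ := fun X => ‖W X‖ * Real.exp (2 * (cellSupp Bond.verts X).card) with hf
  have hf0 : ∀ X, 0 ≤ f X := fun X => by positivity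
  -- Step a: bound by a sum over connected bond sets through `x`
  set Sx := CC.filter fun X => x ∈ cellSupp Bond.verts X with hSx
  have stepA : ∑ A ∈ 𝒜, ‖pushforwardActivity (cellSupp Bond.verts) W CC A‖ * Real.exp (2 * A.card) ≤ ∑ X ∈ Sx, f X := by
    have h1 : ∀ A ∈ 𝒜, ‖pushforwardActivity (cellSupp Bond.verts) W CC A‖ * Real.exp (2 * A.card) ≤
        ∑ X ∈ CC.filter (fun X => cellSupp Bond.verts X = A), f X := by
      intro A _
      rw [pushforwardActivity_apply]
      refine (mul_le_mul_of_nonneg_right (norm_sum_le _ _) (Real.exp_nonneg _)).trans ?_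
      rw [Finset.sum_mul]
      refine Finset.sum_le_sum fun X hX => le_of_eq ?_
      simp only [hf]
      rw [(Finset.mem_filter.1 hX).2]
    refine (Finset.sum_le_sum h1).trans ?_
    rw [← Finset.sum_biUnion]
    · refine Finset.sum_le_sum_of_subset_of_nonneg ?_ fun X _ _ => hf0 X
      intro X hX
      obtain ⟨A, hA, hXA⟩ := Finset.mem_biUnion.1 hX
      obtain ⟨hXCC, hXsupp⟩ := Finset.mem_filter.1 hXA
      exact Finset.mem_filter.2 ⟨hXCC, hXsupp ▸ h𝒜 A hA⟩
    · intro A hA B hB hAB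
      refine Finset.disjoint_left.2 fun X hXA hXB => hAB ?_
      rw [← (Finset.mem_filter.1 hXA).2, ← (Finset.mem_filter.1 hXB).2]
  -- Step b: each term is at most `λ^{|X|}`
  have stepB : ∀ X ∈ Sx, f X ≤ lam ^ X.card := by
    intro X hX
    have hb := hW X (Finset.mem_filter.1 hX).1
    have hs := card_cellSupp_le X
    set k := X.card
    set m := (cellSupp Bond.verts X).card
    calc f X ≤ (Real.exp 2 * s) ^ k * r ^ m * Real.exp (2 * m) :=
          mul_le_mul_of_nonneg_right hb (Real.exp_nonneg _)
      _ ≤ (Real.exp 2 * s) ^ k * r₀ ^ m * Real.exp (2 * m) := by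
          gcongr
      _ = (Real.exp 2 * s) ^ k * (r₀ * Real.exp 2) ^ m := by
          rw [show (2 : ℝ) * m = (m : ℝ) * 2 by ring, Real.exp_nat_mul]; ring
      _ ≤ (Real.exp 2 * s) ^ k * (r₀ * Real.exp 2) ^ (2 * k) := by
          refine mul_le_mul_of_nonneg_left (pow_le_pow_right₀ ?_ hs) (by positivity)
          have : (1 : ℝ) ≤ Real.exp 2 := Real.one_le_exp two_pos.le
          nlinarith
      _ = lam ^ k := by
          rw [hlam, pow_mul, ← mul_pow]
          congr 1
          have h6 : Real.exp 6 = Real.exp 2 ^ 3 := by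
            rw [← Real.exp_nat_mul]; norm_num
          rw [h6]; ring
  -- Step c: cover `Sx` by the families through the bonds at `x`
  set Bx := D.filter fun b => x ∈ Bond.verts b with hBx
  have hcover : Sx ⊆ Bx.biUnion fun b₀ => CC.filter fun X => b₀ ∈ X := by
    intro X hX
    obtain ⟨hXCC, hx⟩ := Finset.mem_filter.1 hX
    obtain ⟨b₀, hb₀X, hxb₀⟩ := mem_cellSupp.1 hx
    have hb₀D : b₀ ∈ D := (mem_connectedCellSets.1 hXCC).1 hb₀X
    exact Finset.mem_biUnion.2 ⟨b₀, Finset.mem_filter.2 ⟨hb₀D, hxb₀⟩, Finset.mem_filter.2 ⟨hXCC, hb₀X⟩⟩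
  have stepC : ∑ X ∈ Sx, lam ^ X.card ≤ ∑ b₀ ∈ Bx, ∑ X ∈ CC.filter (fun X => b₀ ∈ X), lam ^ X.card :=
    (Finset.sum_le_sum_of_subset_of_nonneg hcover fun X _ _ => pow_nonneg hlam0 _).trans
      (sum_biUnion_le_sum_of_nonneg Bx _ _ fun X => pow_nonneg hlam0 _)
  -- Step d/e: entropy bound and the number of bonds at `x`
  have stepD : ∀ b₀ ∈ Bx, ∑ X ∈ CC.filter (fun X => b₀ ∈ X), lam ^ X.card ≤ 2 * lam :=
    fun b₀ _ => sum_pow_card_connectedCellSets_le hΔ hlam0 hsmall b₀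
  have stepE : (Bx.card : ℝ) ≤ 4 * Δ := by exact_mod_cast card_hubbardBonds_mem_verts_le hΔ x
  calc ∑ A ∈ 𝒜, ‖pushforwardActivity (cellSupp Bond.verts) W CC A‖ * Real.exp (2 * A.card)
      ≤ ∑ X ∈ Sx, f X := stepA
    _ ≤ ∑ X ∈ Sx, lam ^ X.card := Finset.sum_le_sum stepB
    _ ≤ ∑ b₀ ∈ Bx, ∑ X ∈ CC.filter (fun X => b₀ ∈ X), lam ^ X.card := stepC
    _ ≤ ∑ _b₀ ∈ Bx, 2 * lam := Finset.sum_le_sum stepD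
    _ = Bx.card * (2 * lam) := by rw [Finset.sum_const, nsmul_eq_mul]
    _ ≤ 4 * Δ * (2 * lam) := mul_le_mul_of_nonneg_right stepE (by positivity)
    _ = 8 * Δ * lam := by ring

/-- **`IsSmallActivityA` of a pushforward activity from a bond-weight bound**: under the hypotheses of
`sum_norm_pushforward_mul_exp_le_of_weight_bound`, if moreover `0 < a`, `0 < δ`, `a + δ ≤ 2` and `8Δλ ≤ a`, the pushforward activity
satisfies the tree's anchored Kotecký–Preiss smallness `IsSmallActivityA ρ_W a δ` — the hypothesis of the convergent cluster expansion
(`IsSmallActivityA.exp_polymerLogZ`, `….polymerPartitionFunction_ne_zero`). -/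
theorem isSmallActivityA_pushforward_of_weight_bound (hΔ : ∀ v : Λ, (Finset.univ.filter (G.Adj v)).card ≤ Δ)
    (W : Finset (Bond Λ) → ℂ) {s r r₀ : ℝ} (hs0 : 0 ≤ s) (hr0 : 0 ≤ r) (hr : r ≤ r₀) (hr₀ : 1 ≤ r₀)
    (hW : ∀ X ∈ connectedCellSets Bond.verts (hubbardBonds G), ‖W X‖ ≤ (Real.exp 2 * s) ^ X.card * r ^ (cellSupp Bond.verts X).card)
    (hsmall : ((8 * Δ : ℕ) + 1 : ℝ) ^ 2 * (Real.exp 6 * r₀ ^ 2 * s) ≤ 1 / 2)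
    {a δ : ℝ} (ha : 0 < a) (hδ : 0 < δ) (had : a + δ ≤ 2) (hsa : 8 * Δ * (Real.exp 6 * r₀ ^ 2 * s) ≤ a) :
    IsSmallActivityA (pushforwardActivity (cellSupp Bond.verts) W (connectedCellSets Bond.verts (hubbardBonds G))) a δ where
  rho_empty := pushforwardActivity_connectedCellSets_empty W _
  a_pos := ha
  delta_pos := hδ
  sum_le x 𝒜 h𝒜 := by
    refine le_trans ?_ ((sum_norm_pushforward_mul_exp_le_of_weight_bound hΔ W hs0 hr0 hr hr₀ hW hsmall x 𝒜 h𝒜).trans hsa)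
    refine Finset.sum_le_sum fun A _ => mul_le_mul_of_nonneg_left (Real.exp_le_exp.2 ?_) (norm_nonneg _)
    exact mul_le_mul_of_nonneg_right had (Nat.cast_nonneg _)

end Summit.Ventures.CertifiedManyBodySolver.Theorems.TcThermcert1.ZeroFreeCorridor

end
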